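import Literature.Probability.Percolation.ArmSeparationSlotDefs
import HarnessLib

/-!
# Arithmetic of the routing: entry pieces, exit runs, windows

Topic: Probability / Percolation; family `crit-perc`. A brick of the discharge of
`Literature.Probability.Percolation.Nolin2008_twoArm_separation` (Nolin 2008, Thm. 11
[arXiv 0711.4948: Thm. 10]; `ArmSeparation.lean`), landing step of the internal extremities
(Nolin 2008, Prop. 12 [arXiv Prop. 11]). Index arithmetic behind the routing functions of
`ArmSeparationSlotDefs.lean`: the tube of the thin ring sitting at the position `piecePos n i ι`
is the `ι`-th piece of the side `i` (`ringTube_piecePos`, `pieceTube`); the spoke of a tip of the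
frame `i` with lateral position `ξ` meets the piece of lateral index `⌊(ξ + r)/s⌋` of the side `i`
(`spokeMeets_pieceTube`, the six junction conditions `SpokeMeets` checked numerically); the pieces
and connectors of an exit run are the ring tubes at the positions `2x, …, 2(x+d)` (`exists_pos_of_mem_vchunks`);
`latIdx_spec` (`-r + ι s ≤ ξ < -r + (ι+1) s`).

## References

* P. Nolin, *Near-critical percolation in two dimensions*, Electron. J. Probab. 13 (2008), §4.3
  Prop. 12, §4.4 [arXiv 0711.4948: Prop. 11, Thm. 10]. [Nolin2008]
-/

noncomputable section

open Set

namespace Literature.Probability.Percolation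

open LatticeModels HalfAnnulus Tube

/-! ### The pieces -/

/-- **The `ι`-th piece of the side `i`** of the thin ring of radius `r = n s`: `V_ι` (`i = 0`),
`H_ι` of the staircase (`i = 1`), `H_{n-1-ι}` of the side `x₁ = r` (`i = 2`), and their reflections
(`i = 3, 4, 5`). [folklore] -/
def pieceTube (r e s n i ι : ℕ) : Tube :=
  match i with
  | 0 => vPiece r (-(r : ℤ)) e s ι
  | 1 => stairH r e s ι
  | 2 => hPiece 0 r e s (n - 1 - ι)
  | 3 => (vPiece r (-(r : ℤ)) e s ι).neg
  | 4 => (stairH r e s ι).neg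
  | 5 => (hPiece 0 r e s (n - 1 - ι)).neg
  | _ => vPiece r (-(r : ℤ)) e s ι

/-- Even positions of the first block of the half ring are the pieces `V_j`. [folklore] -/
theorem halfTube_two_mul {r e s j : ℕ} (hj : j < r / s) : halfTube r e s (2 * j) = vPiece r (-(r : ℤ)) e s j := by
  unfold halfTube; rw [if_pos (by omega), if_pos (by omega), Nat.mul_div_cancel_left _ (by norm_num)]

/-- Odd positions of the first block of the half ring are the connectors `C_j`. [folklore] -/
theorem halfTube_two_mul_add_one {r e s j : ℕ} (hj : j + 1 < r / s) : halfTube r e s (2 * j + 1) = vConn r (-(r : ℤ)) e s j := by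
  unfold halfTube; rw [if_pos (by omega), if_neg (by omega), show (2 * j + 1) / 2 = j by omega]

/-- Even positions of the second block are the steps `H_j`. [folklore] -/
theorem halfTube_stair {r e s j : ℕ} (hj : j < r / s) : halfTube r e s (2 * (r / s) - 1 + 2 * j) = stairH r e s j := by
  unfold halfTube
  rw [if_neg (by omega), if_pos (by omega), show 2 * (r / s) - 1 + 2 * j - (2 * (r / s) - 1) = 2 * j by omega, if_pos (by omega),
    Nat.mul_div_cancel_left _ (by norm_num)]

/-- Even positions of the third block are the pieces `H_j` of the side `x₁ = r`. [folklore] -/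
theorem halfTube_hside {r e s j : ℕ} (hj : j < r / s) : halfTube r e s (4 * (r / s) - 1 + 2 * j) = hPiece 0 r e s j := by
  unfold halfTube
  rw [if_neg (by omega), if_neg (by omega), show 4 * (r / s) - 1 + 2 * j - (4 * (r / s) - 1) = 2 * j by omega, if_pos (by omega),
    Nat.mul_div_cancel_left _ (by norm_num)]

/-- **The tube at the position of a piece is that piece** (`1 ≤ n = r / s`, `i < 6`, `ι < n`). [folklore] -/
theorem ringTube_piecePos {r e s i ι : ℕ} (hr : 1 ≤ r / s) (hi : i < 6) (hι : ι < r / s) :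
    ringTube r e s (piecePos (r / s) i ι) = pieceTube r e s (r / s) i ι := by
  unfold ringTube piecePos blockOff pieceTube
  interval_cases i
  · simp only [Nat.zero_mod, show (0 : ℕ) ≠ 2 from by decide, if_false, Nat.zero_add]
    rw [if_pos (by omega), halfTube_two_mul hι]
  · simp only [Nat.one_mod, show (1 : ℕ) ≠ 2 from by decide, if_false]
    rw [if_pos (by omega), halfTube_stair hι]
  · simp only [show (2 : ℕ) % 3 = 2 from rfl, if_true]
    rw [if_pos (by omega), halfTube_hside (by omega)]
  · simp only [show (3 : ℕ) % 3 = 0 from rfl, show (0 : ℕ) ≠ 2 from by decide, if_false]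
    rw [if_neg (by omega), show 6 * (r / s) - 2 + 2 * ι - (6 * (r / s) - 2) = 2 * ι by omega, halfTube_two_mul hι]
  · simp only [show (4 : ℕ) % 3 = 1 from rfl, show (1 : ℕ) ≠ 2 from by decide, if_false]
    rw [if_neg (by omega), show 8 * (r / s) - 3 + 2 * ι - (6 * (r / s) - 2) = 2 * (r / s) - 1 + 2 * ι by omega, halfTube_stair hι]
  · simp only [show (5 : ℕ) % 3 = 2 from rfl, if_true]
    rw [if_neg (by omega), show 10 * (r / s) - 3 + 2 * (r / s - 1 - ι) - (6 * (r / s) - 2) = 4 * (r / s) - 1 + 2 * (r / s - 1 - ι) by omega,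
      halfTube_hside (by omega)]

/-- The position of a piece is inside the ring (`1 ≤ n`, `i < 6`, `ι < n`). [folklore] -/
theorem piecePos_lt {n i ι : ℕ} (hn : 1 ≤ n) (hi : i < 6) (hι : ι < n) : piecePos n i ι < 12 * n - 4 := by
  unfold piecePos blockOff
  interval_cases i <;> simp <;> omega

/-- The position of a piece lies in the block of its side: `blockOff n i ≤ piecePos n i ι < blockOff n (i+1)`
(with `blockOff n 6 = 12n - 4`; `1 ≤ n`, `i < 6`, `ι < n`). [folklore] -/
theorem piecePos_mem_block {n i ι : ℕ} (hn : 1 ≤ n) (hi : i < 6) (hι : ι < n) :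
    blockOff n i ≤ piecePos n i ι ∧ piecePos n i ι < (if i = 5 then 12 * n - 4 else blockOff n (i + 1)) := by
  unfold piecePos blockOff
  interval_cases i <;> simp <;> omega

/-! ### The lateral index -/

/-- **The lateral index brackets the lateral position**: `-r + ι s ≤ ξ < -r + (ι+1) s` for
`ι = latIdx s r ξ` (`1 ≤ s`, `-r ≤ ξ`). [folklore] -/
theorem latIdx_spec {s r : ℕ} (hs : 1 ≤ s) {ξ : ℤ} (hξ : -(r : ℤ) ≤ ξ) :
    -(r : ℤ) + (latIdx s r ξ : ℕ) * s ≤ ξ ∧ ξ < -(r : ℤ) + ((latIdx s r ξ : ℕ) + 1) * s := by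
  unfold latIdx
  have h0 : (((ξ + r).toNat : ℕ) : ℤ) = ξ + r := by omega
  have h1 : (((ξ + r).toNat / s : ℕ) : ℤ) * s ≤ (ξ + r).toNat := by exact_mod_cast Nat.div_mul_le_self _ _
  have h2 : (((ξ + r).toNat : ℕ) : ℤ) < (((ξ + r).toNat / s : ℕ) : ℤ) * s + s := by exact_mod_cast Nat.lt_div_mul_add hs
  constructor <;> linarith

/-- The lateral index is `< n` when `ξ < 0` (`n s = r`, `1 ≤ n`). [folklore] -/
theorem latIdx_lt {s r n : ℕ} (hn1 : 1 ≤ n) (hn : n * s = r) {ξ : ℤ} (hξ0 : ξ < 0) : latIdx s r ξ < n := by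
  unfold latIdx
  rcases lt_or_ge (ξ + r) 0 with h | h
  · rw [Int.toNat_of_nonpos h.le]; simp only [Nat.zero_div]; exact hn1
  · apply Nat.div_lt_of_lt_mul
    have hn' : ((n * s : ℕ) : ℤ) = r := by exact_mod_cast hn
    have : (((ξ + r).toNat : ℕ) : ℤ) < ((s * n : ℕ) : ℤ) := by rw [mul_comm, hn']; omega
    exact_mod_cast this

/-- Monotonicity of the lateral index. [folklore] -/
theorem latIdx_mono {s r : ℕ} {ξ ξ' : ℤ} (h : ξ ≤ ξ') : latIdx s r ξ ≤ latIdx s r ξ' := by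
  unfold latIdx; exact Nat.div_le_div_right (by omega)

/-! ### The spoke meets its entry piece -/

section Meets

variable {m k : ℕ} {T₀ : ℤ} {w L ε r e s n ι : ℕ}

/-- Frame `0`: the spoke meets `V_ι`. [folklore] -/
theorem spokeMeets_zero (hι : -(r : ℤ) + ι * s ≤ T₀ + 2 * k + w ∧ T₀ + 2 * k + w < -(r : ℤ) + (ι + 1) * s) (hεe : ε ≤ e)
    (ha : (m : ℤ) - 2 * k + 1 + s + e + ε ≤ r + L) (hb : (r : ℤ) + e + ε ≤ (m : ℤ) - 2 * k + 1 + (k / 4 : ℕ)) :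
    SpokeMeets 0 (spokeTube m k T₀ w L ε) (vPiece r (-(r : ℤ)) e s ι) := by
  have hεe' : (ε : ℤ) ≤ e := by exact_mod_cast hεe
  refine ⟨rfl, ?_, ?_, ?_, ?_⟩ <;>
    simp only [spokeTube, bcnCentre, site_mk_apply_zero, site_mk_apply_one, vPiece, Nat.cast_add, Nat.cast_mul, Nat.cast_ofNat] <;>
    linarith [hι.1, hι.2]

/-- Frame `1`: the spoke meets the step `H_ι`. [folklore] -/
theorem spokeMeets_one (hι : -(r : ℤ) + ι * s ≤ T₀ + 2 * k + w ∧ T₀ + 2 * k + w < -(r : ℤ) + (ι + 1) * s) (hεe : ε ≤ e)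
    (ha : (m : ℤ) - 2 * k + 1 + s + e + ε ≤ r + L) (hb : (r : ℤ) + e + ε ≤ (m : ℤ) - 2 * k + 1 + (k / 4 : ℕ)) :
    SpokeMeets 1 (spokeTube m k T₀ w L ε) (stairH r e s ι) := by
  have hεe' : (ε : ℤ) ≤ e := by exact_mod_cast hεe
  refine ⟨rfl, ?_, ?_, ?_, ?_⟩ <;>
    simp only [spokeTube, bcnCentre, site_mk_apply_zero, site_mk_apply_one, stairH, Nat.cast_add, Nat.cast_mul, Nat.cast_ofNat] <;>
    linarith [hι.1, hι.2]

/-- Frame `2`: the spoke meets the piece `H_{n-1-ι}` of the side `x₁ = r` (`n s = r`, `ι < n`). [folklore] -/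
theorem spokeMeets_two (hns : n * s = r) (hιn : ι < n)
    (hι : -(r : ℤ) + ι * s ≤ T₀ + 2 * k + w ∧ T₀ + 2 * k + w < -(r : ℤ) + (ι + 1) * s) (hεe : ε ≤ e)
    (ha : (m : ℤ) - 2 * k + 1 + s + e + ε ≤ r + L) (hb : (r : ℤ) + e + ε ≤ (m : ℤ) - 2 * k + 1 + (k / 4 : ℕ)) :
    SpokeMeets 2 (spokeTube m k T₀ w L ε) (hPiece 0 r e s (n - 1 - ι)) := by
  have hεe' : (ε : ℤ) ≤ e := by exact_mod_cast hεe
  have hns' : (n : ℤ) * s = r := by exact_mod_cast hns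
  have hcast : ((n - 1 - ι : ℕ) : ℤ) = n - 1 - ι := by omega
  refine ⟨rfl, ?_, ?_, ?_, ?_⟩ <;>
    simp only [spokeTube, bcnCentre, site_mk_apply_zero, site_mk_apply_one, hPiece, hcast, Nat.cast_add, Nat.cast_mul,
      Nat.cast_ofNat] <;>
    linarith [hι.1, hι.2]

/-- Frame `3`: the spoke meets `-V_ι`. [folklore] -/
theorem spokeMeets_three (hι : -(r : ℤ) + ι * s ≤ T₀ + 2 * k + w ∧ T₀ + 2 * k + w < -(r : ℤ) + (ι + 1) * s) (hεe : ε ≤ e)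
    (ha : (m : ℤ) - 2 * k + 1 + s + e + ε ≤ r + L) (hb : (r : ℤ) + e + ε ≤ (m : ℤ) - 2 * k + 1 + (k / 4 : ℕ)) :
    SpokeMeets 3 (spokeTube m k T₀ w L ε) (vPiece r (-(r : ℤ)) e s ι).neg := by
  have hεe' : (ε : ℤ) ≤ e := by exact_mod_cast hεe
  refine ⟨rfl, ?_, ?_, ?_, ?_⟩ <;>
    simp only [spokeTube, bcnCentre, site_mk_apply_zero, site_mk_apply_one, vPiece, neg_a, neg_b, neg_w, neg_h, Nat.cast_add,
      Nat.cast_mul, Nat.cast_ofNat] <;>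
    linarith [hι.1, hι.2]

/-- Frame `4`: the spoke meets `-H_ι`. [folklore] -/
theorem spokeMeets_four (hι : -(r : ℤ) + ι * s ≤ T₀ + 2 * k + w ∧ T₀ + 2 * k + w < -(r : ℤ) + (ι + 1) * s) (hεe : ε ≤ e)
    (ha : (m : ℤ) - 2 * k + 1 + s + e + ε ≤ r + L) (hb : (r : ℤ) + e + ε ≤ (m : ℤ) - 2 * k + 1 + (k / 4 : ℕ)) :
    SpokeMeets 4 (spokeTube m k T₀ w L ε) (stairH r e s ι).neg := by
  have hεe' : (ε : ℤ) ≤ e := by exact_mod_cast hεe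
  refine ⟨rfl, ?_, ?_, ?_, ?_⟩ <;>
    simp only [spokeTube, bcnCentre, site_mk_apply_zero, site_mk_apply_one, stairH, neg_a, neg_b, neg_w, neg_h, Nat.cast_add,
      Nat.cast_mul, Nat.cast_ofNat] <;>
    linarith [hι.1, hι.2]

/-- Frame `5`: the spoke meets `-H_{n-1-ι}` (`n s = r`, `ι < n`). [folklore] -/
theorem spokeMeets_five (hns : n * s = r) (hιn : ι < n)
    (hι : -(r : ℤ) + ι * s ≤ T₀ + 2 * k + w ∧ T₀ + 2 * k + w < -(r : ℤ) + (ι + 1) * s) (hεe : ε ≤ e)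
    (ha : (m : ℤ) - 2 * k + 1 + s + e + ε ≤ r + L) (hb : (r : ℤ) + e + ε ≤ (m : ℤ) - 2 * k + 1 + (k / 4 : ℕ)) :
    SpokeMeets 5 (spokeTube m k T₀ w L ε) (hPiece 0 r e s (n - 1 - ι)).neg := by
  have hεe' : (ε : ℤ) ≤ e := by exact_mod_cast hεe
  have hns' : (n : ℤ) * s = r := by exact_mod_cast hns
  have hcast : ((n - 1 - ι : ℕ) : ℤ) = n - 1 - ι := by omega
  refine ⟨rfl, ?_, ?_, ?_, ?_⟩ <;>
    simp only [spokeTube, bcnCentre, site_mk_apply_zero, site_mk_apply_one, hPiece, hcast, neg_a, neg_b, neg_w, neg_h, Nat.cast_add,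
      Nat.cast_mul, Nat.cast_ofNat] <;>
    linarith [hι.1, hι.2]

/-- **The spoke of a tip of the frame `i` meets the piece of its side with the lateral index of the
spoke.** With `ξ = T₀ + 2k + w` the lateral position of the spoke, `ι` such that
`-r + ι s ≤ ξ < -r + (ι+1) s`, `ε ≤ e`, `m - 2k + 1 + s + e + ε ≤ r + L` (the spoke crosses the ring's
band) and `r + e + ε ≤ m - 2k + 1 + k/4` (the ring lies below the beacon), the six junction
conditions hold. [cite: Nolin2008, §4.3 Prop. 12 (proof) (arXiv 0711.4948: Prop. 11)] -/
theorem spokeMeets_pieceTube {i : ℕ} (hi : i < 6) (hns : n * s = r) (hιn : ι < n)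
    (hι : -(r : ℤ) + ι * s ≤ T₀ + 2 * k + w ∧ T₀ + 2 * k + w < -(r : ℤ) + (ι + 1) * s) (hεe : ε ≤ e)
    (ha : (m : ℤ) - 2 * k + 1 + s + e + ε ≤ r + L) (hb : (r : ℤ) + e + ε ≤ (m : ℤ) - 2 * k + 1 + (k / 4 : ℕ)) :
    SpokeMeets i (spokeTube m k T₀ w L ε) (pieceTube r e s n i ι) := by
  interval_cases i
  · exact spokeMeets_zero hι hεe ha hb
  · exact spokeMeets_one hι hεe ha hb
  · exact spokeMeets_two hns hιn hι hεe ha hb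
  · exact spokeMeets_three hι hεe ha hb
  · exact spokeMeets_four hι hεe ha hb
  · exact spokeMeets_five hns hιn hι hεe ha hb

end Meets

/-! ### Exit runs -/

/-- **The tubes of an exit run are ring tubes at the positions `2x, …, 2x + 2d`**: a member of
`vchunks r (-r) e s x (d+1)` (`x + d < n = r/s`) is `ringTube r e s g` for some `g ∈ [2x, 2x + 2d]`. [folklore] -/
theorem exists_pos_of_mem_vchunks {r e s x d : ℕ} (hxd : x + d < r / s) {T : Tube} (hT : T ∈ vchunks r (-(r : ℤ)) e s x (d + 1)) :
    ∃ g, 2 * x ≤ g ∧ g ≤ 2 * x + 2 * d ∧ ringTube r e s g = T := by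
  obtain ⟨i, h1, h2, h3⟩ := mem_vchunks (r : ℤ) (-(r : ℤ)) e s hT
  rcases h3 with rfl | ⟨rfl, h4⟩
  · refine ⟨2 * i, by omega, by omega, ?_⟩
    unfold ringTube; rw [if_pos (by omega), halfTube_two_mul (by omega)]
  · refine ⟨2 * i + 1, by omega, by omega, ?_⟩
    unfold ringTube; rw [if_pos (by omega), halfTube_two_mul_add_one (by omega)]

end Literature.Probability.Percolation
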